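import Mathlib
import HarnessLib
import Summits.PneNP.PneNP.Theorems.FoolingMeasure.Negative.FoolingMeasureFalseOfHalfSparseCore

/-!
# Kill path `NoFoolingMeasure` (stmt-PneNP-19729) from the HALF-SPARSE-CORE hypothesis

Lead prover pnp-aea-p1 g2 (2026-08-27), route `AeaCutRectangles`.  The route files the negation of its crux X1 as
the kill-path item `Summit.PneNP.PneNP.Theses.AeaCutRectangles.NoFoolingMeasure := ¬ FoolingMeasure`
(stmt-PneNP-19729).  The conditional refutation
`Summit.PneNP.PneNP.Theorems.FoolingMeasure.Negative.foolingMeasure_false_of_halfSparseCore` is exactly a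
CONDITIONAL PROOF of that item: `HalfSparseCore → NoFoolingMeasure`, where `HalfSparseCore` ("every 4-critical
graph on `f` vertices has `≥ f/2` vertices spanning `≤ f/2` of its edges") is proved in the tree for all cores with
`≤ 3f - 11` edges (`AeaCutRectanglesSparseCoreLemmaSix.halfSparse_of_core_lt_three`) and open for 4-critical graphs of
average degree `≥ 6` (none with all halves dense is known; the 6-regular 4-critical circulant `C_97(8,10,13)` has a
49-set spanning 28 ≤ 48.5 edges).  This file records the link on the kill-path item.

HONEST FRAMING: bookkeeping (one-line corollary); FRONTIER material for a rung of Fagin's complement ladder;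
nothing here bears on P vs NP.
-/

set_option linter.dupNamespace false
set_option autoImplicit false

namespace Summit.PneNP.PneNP.Theorems.AeaCutRectanglesNoFoolingMeasureOfHalfSparseCore

open Summit.PneNP.PneNP.Theorems.FoolingMeasure.Negative

/-- **The kill path under HALF-SPARSE CORE.**  If every loopless non-3-colourable edge set over `Fin n` has `≥ n/2`
vertices spanning `≤ n/2` edges of some non-3-colourable subgraph (`HalfSparseCore`), then the route's kill-path
item `NoFoolingMeasure` (`¬ FoolingMeasure`, stmt-PneNP-19729) holds. -/
theorem noFoolingMeasure_of_halfSparseCore (hH : HalfSparseCore) :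
    Summit.PneNP.PneNP.Theses.AeaCutRectangles.NoFoolingMeasure := by
  unfold Summit.PneNP.PneNP.Theses.AeaCutRectangles.NoFoolingMeasure
  exact foolingMeasure_false_of_halfSparseCore hH

end Summit.PneNP.PneNP.Theorems.AeaCutRectanglesNoFoolingMeasureOfHalfSparseCore
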